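import Summits.BirchSwinnertonDyer.BirchSwinnertonDyer.Theorems.EisensteinPrimesMazurMCOnCellBShaLowerBound
import Literature.NumberTheory.EllipticCurves.Rank1Residual.Typed.X2RankZeroCertificate
import Literature.NumberTheory.EllipticCurves.SteinWuthrich2013.SplitMultCanonicalHolds
import Literature.NumberTheory.EllipticCurves.SteinWuthrich2013.NonsplitMultCanonicalHolds
import HarnessLib

/-!
# Row A10 (corner X2, `r_an = 0`, ¬GV): the SHA9 composed door — MC ∧ BSD(p) at an X2b pair from
# ONE non-zero element of `Ш(E/ℚ)[p]` when `ord_p #Ш_an ≤ 2` (cell `bsd-eis`, seat k5-c5 g3; RULING L70 (1)(a))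

HONEST FRAMING. THEOREMS ONLY — no definition, no named fact, nothing booked here; BSD is proved for
no curve by this file. It is the words-only CONVENIENCE door behind `OFFER-EIS-A10-SHA9 v1` (referee B
R741, 4/4 on the two ACCEPTED sockets BY NAME): the conjunction of

* the `Ш`-lower-bound MC socket `mazurMainConjectureAt_of_cellB_of_sha_primary_nontrivial`
  (`Theorems/EisensteinPrimesMazurMCOnCellBShaLowerBound.lean`, k5-c3; READ `hne : 1 < #Ш(E)[p^∞]`), and
* the Literature BSD(p) socket `Typed.X2.bsdp_of_casselsTate_of_exists_torsion`
  (`Rank1Residual/Typed/X2RankZeroCertificate.lean`; READ `hsha : ∃ x ∈ Ш(E), x ≠ 0, p • x = 0`),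

with the 3-line bridge `hsha → hne` (`one_lt_card_primaryComponent_of_exists_torsion`, §1) done in the
tree, so that a per-cell certificate is read ONCE, in the shape a `p`-isogeny descent delivers it
(`dim Ш(E₀)[φ] ≥ 1` on the record curve: k5-c5 table `SHA9-A10-TABLE-v1.tsv` ca60d902d8d5a4ea, two
byte-identical litref engines, 4/4 CERT on 165525c1 · 279150d1 · 336354b1 · 495498g1, `#Ш_an = 9`).

PUBLISHED INPUTS BY NAME = the union of the two sockets' binders: `hCT` Cassels–Tate (bsd.S18,
Silverman X.4.14), `hWu` Wuthrich 2014 Thm. 16, `hJs`/`hJn` Stein–Wuthrich 2013 Thm. 6.1, `hGZK`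
Gross–Zagier–Kolyvagin, `hmod` modularity (`exists_isNewformOf`; the BSD(p) socket's
`hasEntireLFunction_rat` is derived from it), `hGS` Greenberg–Stevens at the pair, `hW` Wuthrich 2014
Prop. 21 (`sha_dvd_analyticSha`). The canonical-subgroup existence binders `hHs`/`hHn` of the MC socket
are DISCHARGED inside by the tree theorems `SteinWuthrich2013.exists_isSplitMultCanonical_holds` /
`exists_isMultCanonical_holds` (kernel, no new fact). Per cell: `hc : X2.CellB W p`, `hq : #Ш_an = q`,
`hq2 : ord_p q ≤ 2`, `hsha`. CONDITIONAL on the named published facts; `--supports -19033 --as helper`.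

References: [cite: SilvermanAEC2009, Thm. X.4.14] [cite: Wuthrich2014, Thm. 16 (p. 397) and Prop. 21 (p. 400)]
[cite: SteinWuthrich2013, Thm. 6.1 (p. 20)] [cite: GreenbergStevens1993] [cite: Miller2011LMS, Def. 1.1 (arXiv:1010.2431 p. 3)].
-/

noncomputable section

open scoped Classical

set_option autoImplicit false
set_option linter.dupNamespace false

namespace Summit.BirchSwinnertonDyer.BirchSwinnertonDyer.Theorems.EisensteinPrimesA10Sha9Door

open Summit.BirchSwinnertonDyer.Rank1Residual
  Literature.NumberTheory.EllipticCurves Literature.NumberTheory.EllipticCurves.Rank1Residual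
  Literature.NumberTheory.EllipticCurves.Rank1Residual.Typed
  Literature.NumberTheory.EllipticCurves.ModularForms
  Literature.NumberTheory.EllipticCurves.Wuthrich2014 Literature.NumberTheory.EllipticCurves.SteinWuthrich2013
  Summit.BirchSwinnertonDyer.BirchSwinnertonDyer.Theorems.EisensteinPrimesMazurMCOnCellBShaLowerBound

/-! ## §1 The bridge: one element of order `p` ⇒ the `p`-primary component is non-trivial -/

/-- **Bridge `hsha → hne`.** In a finite additive commutative group `A`, a non-zero element killed by the
prime `p` has additive order `p`, so `p ∣ #A` (Lagrange), `ord_p #A ≥ 1`, and the `p`-primary component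
`A(p)` — of order `p ^ ord_p #A` (`card_addPrimaryComponent_eq_pow`) — has more than one element.
Applied to `A = Ш(E/ℚ)` (finite by GZK at `r_an = 0`). [folklore] -/
theorem one_lt_card_primaryComponent_of_exists_torsion {A : Type*} [AddCommGroup A] [Finite A]
    (p : ℕ) [Fact p.Prime] (h : ∃ x : A, x ≠ 0 ∧ p • x = 0) :
    1 < Nat.card (AddCommGroup.primaryComponent A p) := by
  obtain ⟨x, hx0, hpx⟩ := h
  have hp : p.Prime := Fact.out
  have hdvd : p ∣ Nat.card A := by
    rw [← addOrderOf_eq_prime hpx hx0]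
    exact addOrderOf_dvd_natCard x
  have hA : Nat.card A ≠ 0 := (Nat.card_pos (α := A)).ne'
  have h1 : 1 ≤ (Nat.card A).factorization p :=
    (hp.dvd_iff_one_le_factorization hA).mp hdvd
  rw [card_addPrimaryComponent_eq_pow p]
  calc 1 < p := hp.one_lt
    _ = p ^ 1 := (pow_one p).symm
    _ ≤ p ^ (Nat.card A).factorization p := Nat.pow_le_pow_right hp.pos h1

/-! ## §2 The composed class-wide door (conditional; per cell it reads `hc`, `hq`, `hq2`, `hsha`) -/

/-- **SHA9 door: `X2.MazurMainConjectureAt W p ∧ BSDp W p` at an X2b pair from ONE non-zero element of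
`Ш(E/ℚ)[p]` when `ord_p #Ш(E/ℚ)_an ≤ 2`.** Inputs BY NAME: Cassels–Tate `hCT`, Wuthrich 2014 Thm. 16
`hWu` and Prop. 21 `hW`, Stein–Wuthrich 2013 Thm. 6.1 `hJs`/`hJn` (their §4.2 canonical-subgroup
existence discharged by the tree's `exists_isSplitMultCanonical_holds` / `exists_isMultCanonical_holds`),
Gross–Zagier–Kolyvagin `hGZK`, modularity `hmod`, Greenberg–Stevens `hGS` at the pair; per cell
`hc : X2.CellB W p` (`r_an = 0`, class X2, ¬GV), `#Ш_an = q` with `ord_p q ≤ 2`, and the descent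
certificate `hsha`. First conjunct: the k5-c3 socket `mazurMainConjectureAt_of_cellB_of_sha_primary_nontrivial`
through the bridge of §1 (`Ш` finite by `hGZK` at `hc.1`); second conjunct: the Literature socket
`Typed.X2.bsdp_of_casselsTate_of_exists_torsion` (`hr := hc.1`, `hX := hc.2.1`,
`hasEntireLFunction_rat` from `hmod`). CONDITIONAL; nothing closed; per-pair, not a class theorem.
[cite: SilvermanAEC2009, Thm. X.4.14] [cite: Wuthrich2014, Thm. 16 (p. 397) and Prop. 21 (p. 400)]
[cite: SteinWuthrich2013, Thm. 6.1 (p. 20)] [cite: GreenbergStevens1993]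
[cite: Miller2011LMS, Def. 1.1 (arXiv:1010.2431 p. 3)] -/
theorem X2.cellB_mazurMC_and_bsdp_of_descent_of_facts
    (hCT : WeierstrassCurve.exists_casselsTate_pairing (K := ℚ))
    (hWu : thm16_charIdeal_dvd_multiplicative_of_reducible)
    (hJs : thm61_splitMultiplicative) (hJn : thm61_nonsplitMultiplicative)
    (hGZK : rank_eq_analyticRank_of_analyticRank_le_one) (hmod : exists_isNewformOf)
    (hW : sha_dvd_analyticSha)
    (W : WeierstrassCurve ℚ) [W.IsElliptic] [W.IsGloballyMinimal] (p : ℕ) [Fact p.Prime]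
    (hGS : greenberg_stevens (W := W) (p := p)) (hc : X2.CellB W p)
    {q : ℚ} (hq : shaAn W = (q : ℂ)) (hq2 : padicValRat p q ≤ 2)
    (hsha : ∃ x : W.sha, x ≠ 0 ∧ p • x = 0) :
    X2.MazurMainConjectureAt W p ∧ BSDp W p := by
  haveI : Finite W.sha := (hGZK W (by rw [hc.1]; exact zero_le_one)).2
  refine ⟨?_, ?_⟩
  · exact mazurMainConjectureAt_of_cellB_of_sha_primary_nontrivial W p hCT hWu hJs hJn
      exists_isSplitMultCanonical_holds exists_isMultCanonical_holds hGZK hmod hGS hc hq hq2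
      (one_lt_card_primaryComponent_of_exists_torsion p hsha)
  · exact Literature.NumberTheory.EllipticCurves.Rank1Residual.Typed.X2.bsdp_of_casselsTate_of_exists_torsion
      W p hCT hW hGZK (WeierstrassCurve.hasEntireLFunction_rat_of_exists_isNewformOf hmod) hc.1 hc.2.1
      hq hq2 hsha

/-- **The same door at analytic rank `0` stated with the three atoms of `X2.CellB` as separate binders**
(`hr : r_an = 0`, `hX : ClassX2 W p`, `hngv : ¬ GVPar W p`) — the shape in which the census keys carry
them (atlas subcell4 ∈ {split-notGV, nonsplit-notGV}). [cite: SilvermanAEC2009, Thm. X.4.14]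
[cite: Wuthrich2014, Thm. 16 (p. 397) and Prop. 21 (p. 400)] [cite: SteinWuthrich2013, Thm. 6.1 (p. 20)] -/
theorem X2.mazurMC_and_bsdp_of_descent_of_facts_of_not_gvPar
    (hCT : WeierstrassCurve.exists_casselsTate_pairing (K := ℚ))
    (hWu : thm16_charIdeal_dvd_multiplicative_of_reducible)
    (hJs : thm61_splitMultiplicative) (hJn : thm61_nonsplitMultiplicative)
    (hGZK : rank_eq_analyticRank_of_analyticRank_le_one) (hmod : exists_isNewformOf)
    (hW : sha_dvd_analyticSha)
    (W : WeierstrassCurve ℚ) [W.IsElliptic] [W.IsGloballyMinimal] (p : ℕ) [Fact p.Prime]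
    (hGS : greenberg_stevens (W := W) (p := p)) (hr : W.analyticRank = 0) (hX : ClassX2 W p)
    (hngv : ¬ GVPar W p) {q : ℚ} (hq : shaAn W = (q : ℂ)) (hq2 : padicValRat p q ≤ 2)
    (hsha : ∃ x : W.sha, x ≠ 0 ∧ p • x = 0) :
    X2.MazurMainConjectureAt W p ∧ BSDp W p :=
  X2.cellB_mazurMC_and_bsdp_of_descent_of_facts hCT hWu hJs hJn hGZK hmod hW W p hGS ⟨hr, hX, hngv⟩
    hq hq2 hsha

end Summit.BirchSwinnertonDyer.BirchSwinnertonDyer.Theorems.EisensteinPrimesA10Sha9Door
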